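import Summits.QuantumFields.BalabanUV.T4Continuum.Support.NE7ApeCurvedRepSameTopH
import HarnessLib

/-!
# NE7ApeCurvedRepSameTopCriticalH — TWIN (t4-ne7-p1 gen 80) of `NE7ApeCurvedRepSameTopCritical` with the slice-solver letter in the HOMOGENEOUS TWO-TERM shape (L2)ʰ `‖curlAt W X‖ ≤ K_G·g + K_X·R` (`R` a sup bound of `X`)
# and the normal part's sup bound `a_N` displayed; conclusion radius gains `+ K_X·(α₀ + a_N)` next to `c_N`.  WHY: the one-term letter of the original (with `hS ⊇ tangent` downstream)
# is UNSATISFIABLE at curved data (F128 `NE7SliceLetterGaugeObstruction`, F130 `NE7SliceLetterConstantFluxWitness`); (L2)ʰ is consistent at every background (trivially with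
# `K_G = 0`, `K_X = 4`) and its content is the size of `(K_G, K_X)`.  Memo `t4/b2b-balaban-t4-ne7-p1-g80/SLICE-LETTER-OBSTRUCTION.md` §3.  Everything else VERBATIM from the original
# (whose header follows); HONEST FRAMING as there: composition over displayed letters, nothing of Bałaban's asserted, (APE) on curved data NOT proved, NOT NE7, spine 0∕9, NOT Clay.
-/

/-!
# NE7ApeCurvedRepSameTopCritical — (APE) WITH A DATUM AT A TANGENT-CRITICAL BACKGROUND, FIBRE-PRESERVING REPRESENTATIVE: F76 with the tension letter (L3)
# DISCHARGED (`κ = 0` because `W` is tangent-critical on its fibre) — the displayed analytic letters are now exactly (L1) the normal lift (`ν`, `c_N`), the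
# gradient member `α₁`, and (L2) the slice solver `K_G`; file 12

Cell `pub-balaban`, rung (B)+1 sub-cell t4, lineage `b2b-balaban-t4-ne7-p1` (CRUX PROVER NE7 #1 = OWNER of row NE7), generation 76; memo
`t4/b2b-balaban-t4-ne7-p1-g76/TT-CURVED-LETTER.md`.  File F78 (over F76 `NE7ApeCurvedRepSameTop.smallField_of_tanCritical_repSameTop`).
WHY (memo `…-g75/CURVED-APE-ROAD.md` §2 (L3)).  The natural background of the (APE) with a datum is the fibre's regular critical point of the previous induction step —
TANGENT-CRITICAL: `dAction W Y = 0` on every `W`-tangent `Y`, i.e. the tension letter holds with `κ = 0`.  THIS FILE records that specialisation of F76, so that the curved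
(APE)'s open list reads, in kernel: «REP WITH A FIXED TOP» (the displayed representative), (L1) normal lift of `Z` at `W`, the gradient member `α₁`, (L2) slice solver.
WHAT ([folklore]; 0 def, 0 sorry).  **`smallField_of_tanCritical_repSameTop_critBackground`** — F76 with `hWten` replaced by `hcritW` and `κ` by `0`.
HONEST FRAMING (page 1): a specialisation; (L1), `α₁`, (L2) and the fixed-top representative are HYPOTHESES; nothing of Bałaban's asserted; (APE) on curved data NOT proved;
NOT ONE-STEP, NOT NE7; spine 0∕9; finite T⁴ rung (B)+1 — NOT infinite volume, NOT mass gap, NOT `BetaPertH`, NOT Clay.  Continuum YM on T⁴ ⇐ BetaPertH ∧ nine spine estimates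
(0/9 proved); BetaPertH ⇐ (D1) ∧ (D4) ∧ CAP+tail; G-an2-4 gates asym, D1 and NE2/3/4.
-/

set_option autoImplicit false

open scoped BigOperators Matrix Matrix.Norms.L2Operator
open NormedSpace Finset Set

namespace Summit.QuantumFields.BalabanUV.T4Continuum.NE7ApeCurvedRepSameTopCriticalH

open Literature.MathematicalPhysics.QuantumFieldTheory.Balaban1983to89
open B7Prop1Explicit B7Prop2Explicit MatrixLog UnitaryModel
open T4AveragingDeficitWall (Ad IsUnitaryCfg IsSkewDir SmallField vary curlAt dirL1)
open T4AveragingDeficitWallBoundary (IsPeriodicCfg periodBox)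
open AveragingDeficitPeriodicCounting (IsPeriodicDir)
open AveragingDeficitTwoLevelPrep (twoLevelSmall)
open AveragingDeficitMultiLevelPrep (cavgIter LevelSmall)
open MinimalActionLevels (perWin)
open BlockAverageVaryHolo (nbRad)
open NE3HessForm (hess dAction)
open NE3TangentCovariantTower (dirIter)
open NE3EnergyShapes (IsUnitarySite IsPeriodicSite)
open NE3QbarIterCovLiftPrep (cruxC)
open NE3RightInverseSolveLetters (thetaLoc)
open NE3HatInvCurlLetters (curl1C)
open NE7ApeCurvedRepSameTopH (smallField_of_tanCritical_repSameTop)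

noncomputable section

variable {d : ℕ} {n : Type*} [Fintype n] [DecidableEq n]

/-- **(APE) WITH A DATUM AT A TANGENT-CRITICAL BACKGROUND, FIBRE-PRESERVING REPRESENTATIVE** (statement in the module docstring). [folklore] -/
theorem smallField_of_tanCritical_repSameTop_critBackground [Nonempty n] (hd : 2 ≤ d) {L N : ℕ} [NeZero N] (hL : 2 ≤ L) (j : ℕ)
    -- the background
    {W : Site d → Fin d → (Matrix n n ℂ)ˣ} {x : ℝ} (hWu : IsUnitaryCfg W) (hWP : IsPeriodicCfg W ((N * L ^ (j + 1) : ℕ) : ℤ))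
    (hx : 0 ≤ x) (hs : LevelSmall d L j x) (hWx : SmallField W x)
    -- the sup radius of the representative and the regime at `x′ = x + 4(e^{α₀} − 1)`
    {α₀ : ℝ} (hα0 : 0 ≤ α₀) (hs' : LevelSmall d L j (x + 4 * (Real.exp α₀ - 1)))
    (hθ : cruxC d L * (((L : ℝ) ^ (j + 1)) ^ 2 * (x + 4 * (Real.exp α₀ - 1))) < 1)
    (hθl : thetaLoc d L * (((L : ℝ) ^ (j + 1)) ^ 2 * (x + 4 * (Real.exp α₀ - 1))) < 1)
    (hε : ((L : ℝ) ^ (j + 1)) ^ 2 * (x + 4 * (Real.exp α₀ - 1)) ≤ 1)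
    -- the field: of the class, tangent-critical
    {U : Site d → Fin d → (Matrix n n ℂ)ˣ} (hUu : IsUnitaryCfg U)
    {xU : ℝ} (hxU : 0 ≤ xU) (hsU : LevelSmall d L j xU) (hUxU : SmallField U xU)
    (hcritU : ∀ Y : Site d → Fin d → Matrix n n ℂ, IsSkewDir Y → IsPeriodicDir Y ((N * L ^ (j + 1) : ℕ) : ℤ) →
      dirIter L (j + 1) U Y = 0 → dAction U Y (perWin d (N * L ^ (j + 1))) = 0)
    -- the DISPLAYED fibre-preserving representative `U^u = W e^{Z}`
    {u : Site d → (Matrix n n ℂ)ˣ} (huU : IsUnitarySite u) (huP : IsPeriodicSite u ((N * L ^ (j + 1) : ℕ) : ℤ))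
    {Z : Site d → Fin d → Matrix n n ℂ} (hZs : IsSkewDir Z) (hZP : IsPeriodicDir Z ((N * L ^ (j + 1) : ℕ) : ℤ))
    (hrep : gaugeAct u U = vary W Z 1) (hZα : ∀ y μ, ‖Z y μ‖ ≤ α₀)
    (hTopZ : cavgIter L (j + 1) (vary W Z 1) = cavgIter L (j + 1) W)
    -- the remaining analytic letters at `W`: (L1) normal lift of `Z`, the gradient member, (L2) slice solver, (L3) tension
    (S : Set (Site d → Fin d → Matrix n n ℂ)) {cN aN KG KX ν : ℝ} (hν : 0 ≤ ν)
    {AN : Site d → Fin d → Matrix n n ℂ} (hNP : IsPeriodicDir AN ((N * L ^ (j + 1) : ℕ) : ℤ)) (hNsup : ∀ y μ, ‖AN y μ‖ ≤ aN)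
    (hNexact : dirIter L (j + 1) W AN = dirIter L (j + 1) W Z)
    (hN7 : ∀ z μ' ν', μ' ≠ ν' → ‖curlAt W AN z μ' ν'‖ ≤ cN)
    (hNorth : ∀ Y : Site d → Fin d → Matrix n n ℂ, IsSkewDir Y → IsPeriodicDir Y ((N * L ^ (j + 1) : ℕ) : ℤ) → dirIter L (j + 1) W Y = 0 →
      |hess W AN Y (perWin d (N * L ^ (j + 1)))| ≤ ν * dirL1 Y (periodBox (d := d) (N * L ^ (j + 1))))
    (hTS : (fun y μ => Z y μ - AN y μ) ∈ S)
    {α₁ : ℝ} (hα1 : 0 ≤ α₁) (hZ1 : ∀ (y : Site d) (κ τ : Fin d), ‖Ad (W (y + e κ) τ) (Z (y + e τ) κ) - Z y κ‖ ≤ α₁)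
    (hG : ∀ X ∈ S, IsPeriodicDir X ((N * L ^ (j + 1) : ℕ) : ℤ) → dirIter L (j + 1) W X = 0 → ∀ R : ℝ, (∀ y κ', ‖X y κ'‖ ≤ R) → ∀ g : ℝ, 0 ≤ g →
      (∀ Y : Site d → Fin d → Matrix n n ℂ, IsSkewDir Y → IsPeriodicDir Y ((N * L ^ (j + 1) : ℕ) : ℤ) → dirIter L (j + 1) W Y = 0 →
        |hess W X Y (perWin d (N * L ^ (j + 1)))| ≤ g * dirL1 Y (periodBox (d := d) (N * L ^ (j + 1)))) →
      ∀ z μ' ν', μ' ≠ ν' → ‖curlAt W X z μ' ν'‖ ≤ KG * g + KX * R)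
    -- (L3) DISCHARGED: the background is tangent-critical
    (hcritW : ∀ Y : Site d → Fin d → Matrix n n ℂ, IsSkewDir Y → IsPeriodicDir Y ((N * L ^ (j + 1) : ℕ) : ℤ) → dirIter L (j + 1) W Y = 0 →
      dAction W Y (perWin d (N * L ^ (j + 1))) = 0) :
    SmallField U (x + (KG * (
        ((x + 4 * (Real.exp α₀ - 1))
            * ((curl1C d L / (1 - thetaLoc d L * (((L : ℝ) ^ (j + 1)) ^ 2 * (x + 4 * (Real.exp α₀ - 1)))))
                * (((L : ℝ) ^ (j + 1)) ^ d / ((L : ℝ) ^ (j + 1)) ^ 2))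
            * (Real.exp (((L : ℝ) ^ d / L) * ((d : ℝ) * (16 * ((d : ℝ) + 1) * ((d : ℝ) + 4) * (L : ℝ) ^ 2)
                  * (1250 * ((nbRad d L : ℝ) + L) + 8 * ((d : ℝ) * L) + 2 * L)) * (2 / twoLevelSmall d L))
                * ((L : ℝ) / (L : ℝ) ^ d) ^ j
                * (((d : ℝ) * (2 * nbRad d L + 1) ^ d) * ((2 * (d : ℝ) + 4) * (L : ℝ) ^ 2) * (2 * (L : ℝ) ^ j) * (Real.exp α₀ - 1)
                  + (17 / 8 * ((L : ℝ) ^ 2) ^ j * (x + 4 * (Real.exp α₀ - 1)))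
                    * (((d : ℝ) * (2 * nbRad d L + 1) ^ d) * ((2 * (d : ℝ) + 4)
                          * (2 * (2 * L * (nbRad d L : ℝ) + 128 * ((d : ℝ) + 1) * ((d : ℝ) + 4) * (L : ℝ) ^ 2)))
                      + ((d : ℝ) * (2 * nbRad d L + 1) ^ d) * ((2 * (d : ℝ) + 4) * (L : ℝ) ^ 2 * (2 * (nbRad d L : ℝ))
                          + 2 * (8 * (L : ℝ) + (1250 * ((nbRad d L : ℝ) + L) + 8 * (d * L) + 2 * L))
                              * (16 * ((d : ℝ) + 1) * ((d : ℝ) + 4) * (L : ℝ) ^ 2))))))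
        + (Fintype.card (T4AveragingDeficitWall.Plane d) : ℝ)
          * (2 * (240 * (Real.exp α₀ - 1) * α₀ * (2 * α₁ + 24 * α₀ * (Real.exp α₀ - 1) + x) + 8 * α₀ * (2 * α₁ + 24 * α₀ * (Real.exp α₀ - 1))
              + 6 * (Real.exp α₀ - 1) * (2 * α₁ + 24 * (Real.exp α₀ - 1) * α₀)
              + (2 * α₁ + 24 * (Real.exp α₀ - 1) * α₀) * (2 * α₁ + 24 * α₀ * (Real.exp α₀ - 1))
              + 960 * (Real.exp α₀ - 1) * α₀ ^ 2 + 32 * x * α₀ ^ 2)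
            + (64 * α₀ * α₁ + 1024 * x * α₀ ^ 2))
        + ν) + KX * (α₀ + aN) + cN + 28 * α₀ ^ 2)) := by
  have hWten : ∀ Y : Site d → Fin d → Matrix n n ℂ, IsSkewDir Y → IsPeriodicDir Y ((N * L ^ (j + 1) : ℕ) : ℤ) → dirIter L (j + 1) W Y = 0 →
      |dAction W Y (perWin d (N * L ^ (j + 1)))| ≤ (0 : ℝ) * dirL1 Y (periodBox (d := d) (N * L ^ (j + 1))) := by
    intro Y hY hYP hYT
    rw [hcritW Y hY hYP hYT, abs_zero, zero_mul]
  have h := smallField_of_tanCritical_repSameTop hd hL j hWu hWP hx hs hWx hα0 hs' hθ hθl hε hUu hxU hsU hUxU hcritU huU huP hZs hZP hrep hZα hTopZ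
    S le_rfl hν hNP hNsup hNexact hN7 hNorth hTS hα1 hZ1 hG hWten
  simpa only [add_zero] using h

end

end Summit.QuantumFields.BalabanUV.T4Continuum.NE7ApeCurvedRepSameTopCriticalH
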